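import Mathlib
import Summits.NavierStokesRegularity.NavierStokesRegularity.Theorems.LerayQuarterDissipationFiniteDissipationLiouvilleVorticityAmplitudeTools
import Literature.Analysis.FluidPDE.ConstantinDirectionDissipationCalculus
import HarnessLib

/-!
# Crux `FiniteDissipationLiouville` (stmt-NavierStokesRegularity-22144): the trace-free stretching
# inequality `3⟪DU Ω, Ω⟫² ≤ (2|DU|²_F − |curl U|²)‖Ω‖⁴` and the stretching term priced by the
# vorticity amplitude, `2∫φ_R²⟪DU Ω, Ω⟫ ≤ (2/√3) C_ω ∫‖Ω‖²` (vorticity-amplitude threshold, file 2/3)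

Theorems file of route `LerayQuarterDissipation` (lead prover g15; `--supports` the crux; tools
for `…VorticityAmplitude`). Navier–Stokes regularity is NOT proved by anything here; no summit is.

`𝒟_{C,K}`: Type-I ancient mild fields `V` (KNSS gauge, `IsTypeIAncientMild C V`) with the
quarter-rate law `∫ ‖DV(t)‖² ≤ K/√(−t)`; `U = lerayOrbit V`, `Ω = lerayVorticity V = curl U`.

* `three_mul_sq_quadForm_le`, `three_mul_sq_inner_apply_le` — POINTWISE KINEMATICS: for a
  trace-free linear map `L : ℝ³ → ℝ³` (`Σᵢ (L eᵢ)ᵢ = 0`) and every vector `v`,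
  `3⟪L v, v⟫² ≤ (2|L|²_F − ‖curlCLM L‖²)·‖v‖⁴`. With `S = ½(L + Lᵀ)` (trace-free) one has
  `⟪Lv,v⟫ = ⟨S, v⊗v − ⅓‖v‖²I⟩_F`, Cauchy–Schwarz in the nine entries, `|v⊗v − ⅓‖v‖²I|²_F = ⅔‖v‖⁴`
  and `|S|²_F = |L|²_F − ½‖curl‖²`; equivalently `⟪Sξ,ξ⟫ ≤ √(2/3)|S|_F` for unit `ξ` — the largest
  eigenvalue of a trace-free symmetric `3×3` matrix is at most `√(2/3)` of its Frobenius norm.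
* `inner_fderiv_apply_le_of_norm_le` — hence, where `‖Ω‖ ≤ C_ω` and `div U = 0`:
  `⟪DU Ω, Ω⟫ ≤ γ·((2|DU|²_F − ‖curl U‖²) + ‖Ω‖²)`, `γ = C_ω√3/6` (AM–GM on `3a² ≤ X·C_ω²·‖Ω‖²`).
* `two_mul_integral_sqCutoff_stretching_le_sharp` — **the stretching term of the localised
  similarity-enstrophy budget priced by the vorticity amplitude**: if `‖Ω(s,·)‖ ≤ C_ω` then for every
  `R > 0`, `2∫φ_R²⟪DU Ω, Ω⟫ ≤ (2C_ω√3/3)·∫‖Ω(s)‖² = (2/√3) C_ω Z_∞(s)`, using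
  `∫ |DU(s)|²_F = ∫ ‖Ω(s)‖²` (file 1/3, `integral_frobeniusNormSq_fderiv_eq_of_isDivFree`) so that
  `∫ (2|DU|²_F − ‖curl U‖²) = Z_∞(s)` — i.e. `∫|S|²_F = ½ Z_∞`: half of the Dirichlet integral of a
  divergence-free field is strain, half is rotation.

HONEST FRAMING. Kinematic inequalities and one estimate about a HYPOTHETICAL class; nothing here
bears on Navier–Stokes regularity or blow-up.

References: Majda–Bertozzi 2002 §1.2 (1.20)–(1.24) (strain/rotation splitting); Doering–Gibbon 1995
§1.4; Constantin, Comm. Math. Phys. 129 (1990) §2 (the stretching density). [folklore]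
-/

noncomputable section

set_option linter.dupNamespace false

namespace Summit.NavierStokesRegularity.NavierStokesRegularity.Theorems.FiniteDissipationLiouville.VorticityAmplitude

open MeasureTheory Set Filter Topology Metric InnerProductSpace Function Real
open scoped RealInnerProductSpace ContDiff ENNReal
open Literature.Analysis Literature.Analysis.FluidPDE
open Summit.NavierStokesRegularity.NavierStokesRegularity.Theorems
open Summit.NavierStokesRegularity.NavierStokesRegularity.Theorems.GaussianGap
open Summit.NavierStokesRegularity.NavierStokesRegularity.Theorems.SimilarityEnstrophy
open Summit.NavierStokesRegularity.NavierStokesRegularity.Theorems.SmallDissipationGap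

variable {C : ℝ} {V : ℝ → (EuclideanSpace ℝ (Fin 3)) → (EuclideanSpace ℝ (Fin 3))}

/-! ### Pointwise kinematics: the trace-free stretching inequality -/

section Kinematics

/-- **Algebraic core.** For a real `3 × 3` array `m` (think `mᵢⱼ = ∂ⱼUᵢ`) with zero trace, its
curl vector `w = (m₂₁ − m₁₂, m₀₂ − m₂₀, m₁₀ − m₀₁)` and any `v`:
`3 (vᵀ m v)² ≤ (2 Σ mᵢⱼ² − |w|²) (Σ vᵢ²)²`. Proof: `vᵀ m v = Σ Sᵢⱼ Pᵢⱼ` with `S = ½(m + mᵀ)`,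
`P = v vᵀ − ⅓|v|² I` (here the trace condition enters), Cauchy–Schwarz in the nine entries,
`Σ Pᵢⱼ² = ⅔ |v|⁴` and `Σ Sᵢⱼ² = Σ mᵢⱼ² − ½|w|²`. [folklore] -/
theorem three_mul_sq_quadForm_le (m : Fin 3 → Fin 3 → ℝ) (v w : Fin 3 → ℝ)
    (h0 : w 0 = m 2 1 - m 1 2) (h1 : w 1 = m 0 2 - m 2 0) (h2 : w 2 = m 1 0 - m 0 1)
    (htr : m 0 0 + m 1 1 + m 2 2 = 0) :
    3 * (∑ i, v i * ∑ j, v j * m i j) ^ 2 ≤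
      (2 * (∑ j, ∑ i, m i j ^ 2) - ∑ i, w i ^ 2) * (∑ i, v i ^ 2) ^ 2 := by
  set S2 : ℝ := ∑ i, ∑ j, ((m i j + m j i) / 2) ^ 2 with hS2def
  set F : ℝ := ∑ j, ∑ i, m i j ^ 2 with hFdef
  set c2 : ℝ := ∑ i, w i ^ 2 with hc2def
  set n : ℝ := ∑ i, v i ^ 2 with hndef
  set P : Fin 3 → Fin 3 → ℝ := ![![v 0 * v 0 - n / 3, v 0 * v 1, v 0 * v 2],
    ![v 1 * v 0, v 1 * v 1 - n / 3, v 1 * v 2], ![v 2 * v 0, v 2 * v 1, v 2 * v 2 - n / 3]] with hPdef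
  have hn3 : n = v 0 ^ 2 + v 1 ^ 2 + v 2 ^ 2 := by simp only [hndef, Fin.sum_univ_three]
  have e1 : ∑ i, v i * ∑ j, v j * m i j =
      ∑ p : Fin 3 × Fin 3, ((m p.1 p.2 + m p.2 p.1) / 2) * P p.1 p.2 := by
    simp only [Fintype.sum_prod_type, Fin.sum_univ_three, hPdef]
    simp only [Matrix.cons_val_zero, Matrix.cons_val_one, Matrix.cons_val_two, Matrix.head_cons,
      Matrix.tail_cons, Fin.isValue]
    rw [hn3]
    linear_combination ((v 0 ^ 2 + v 1 ^ 2 + v 2 ^ 2) / 3) * htr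
  have e2 : ∑ p : Fin 3 × Fin 3, (P p.1 p.2) ^ 2 = 2 / 3 * n ^ 2 := by
    simp only [Fintype.sum_prod_type, Fin.sum_univ_three, hPdef]
    simp only [Matrix.cons_val_zero, Matrix.cons_val_one, Matrix.cons_val_two, Matrix.head_cons,
      Matrix.tail_cons, Fin.isValue]
    rw [hn3]; ring
  have e3 : ∑ p : Fin 3 × Fin 3, ((m p.1 p.2 + m p.2 p.1) / 2) ^ 2 = S2 := by
    simp only [Fintype.sum_prod_type, hS2def]
  have hCS : (∑ i, v i * ∑ j, v j * m i j) ^ 2 ≤ S2 * (2 / 3 * n ^ 2) := by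
    rw [e1, ← e2, ← e3]
    exact Finset.sum_mul_sq_le_sq_mul_sq _ _ _
  have hS2 : S2 = F - c2 / 2 := by
    simp only [hS2def, hFdef, hc2def, Fin.sum_univ_three, h0, h1, h2]
    ring
  rw [hS2] at hCS
  nlinarith [hCS]

/-- **The trace-free stretching inequality.** For a linear map `L : ℝ³ → ℝ³` with zero trace
(`Σᵢ (L eᵢ)ᵢ = 0`) and every `v`: `3⟪L v, v⟫² ≤ (2|L|²_F − ‖curlCLM L‖²) ‖v‖⁴`; i.e. with
`S = ½(L + Lᵀ)`, `⟪Sξ, ξ⟫² ≤ ⅔|S|²_F` for unit `ξ` — the top eigenvalue of a trace-free symmetric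
`3 × 3` matrix is at most `√(2/3)` of its Frobenius norm (equality for `diag(2,−1,−1)`). [folklore] -/
theorem three_mul_sq_inner_apply_le
    (L : (EuclideanSpace ℝ (Fin 3)) →L[ℝ] (EuclideanSpace ℝ (Fin 3)))
    (htr : ∑ i, L ((EuclideanSpace.basisFun (Fin 3) ℝ) i) i = 0) (v : EuclideanSpace ℝ (Fin 3)) :
    3 * ⟪L v, v⟫ ^ 2 ≤ (2 * frobeniusNormSq L - ‖curlCLM L‖ ^ 2) * ‖v‖ ^ 4 := by
  have hexp : ∀ y : (EuclideanSpace ℝ (Fin 3)),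
      y = ∑ j, y j • ((EuclideanSpace.basisFun (Fin 3) ℝ) j : (EuclideanSpace ℝ (Fin 3))) :=
    fun y => (((EuclideanSpace.basisFun (Fin 3) ℝ)).sum_repr y).symm
  have hL : ∀ i, (L v) i = ∑ j, v j * L ((EuclideanSpace.basisFun (Fin 3) ℝ) j) i := by
    intro i
    conv_lhs => rw [hexp v, map_sum]
    simp [map_smul]
  have hinner : ⟪L v, v⟫ = ∑ i, v i * ∑ j, v j * L ((EuclideanSpace.basisFun (Fin 3) ℝ) j) i := by
    rw [real_inner_comm, PiLp.inner_apply]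
    refine Finset.sum_congr rfl fun i _ => ?_
    rw [hL i]
    simp [mul_comm]
  have hnorm : ‖v‖ ^ 2 = ∑ i, v i ^ 2 := by
    rw [EuclideanSpace.norm_sq_eq]
    simp [Real.norm_eq_abs, sq_abs]
  have hnormc : ‖curlCLM L‖ ^ 2 = ∑ i, (curlCLM L) i ^ 2 := by
    rw [EuclideanSpace.norm_sq_eq]
    simp [Real.norm_eq_abs, sq_abs]
  have htr' : L ((EuclideanSpace.basisFun (Fin 3) ℝ) 0) 0 + L ((EuclideanSpace.basisFun (Fin 3) ℝ) 1) 1 +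
      L ((EuclideanSpace.basisFun (Fin 3) ℝ) 2) 2 = 0 := by
    simpa [Fin.sum_univ_three] using htr
  obtain ⟨h0, h1, h2⟩ := curlCLM_apply_coord L
  rw [hinner, show ‖v‖ ^ 4 = (‖v‖ ^ 2) ^ 2 by ring, hnorm, hnormc, frobeniusNormSq_eq_sum_sq_coord]
  exact three_mul_sq_quadForm_le (fun i j => L ((EuclideanSpace.basisFun (Fin 3) ℝ) j) i) (fun i => v i)
    (fun i => curlCLM L i) h0 h1 h2 htr'

/-- The trace in the standard coordinates: `tr L = Σᵢ (L eᵢ)ᵢ`. [folklore] -/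
theorem traceCLM_eq_sum_coord (L : (EuclideanSpace ℝ (Fin 3)) →L[ℝ] (EuclideanSpace ℝ (Fin 3))) :
    traceCLM L = ∑ i, L ((EuclideanSpace.basisFun (Fin 3) ℝ) i) i := by
  rw [traceCLM_eq_sum_inner (EuclideanSpace.basisFun (Fin 3) ℝ)]
  refine Finset.sum_congr rfl fun i _ => ?_
  rw [EuclideanSpace.basisFun_apply, EuclideanSpace.inner_single_left]
  simp

/-- `‖curl‖² ≤ 2|L|²_F`, so the strain weight `2|L|²_F − ‖curlCLM L‖²` is non-negative. [folklore] -/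
theorem two_mul_frobeniusNormSq_sub_nonneg
    (L : (EuclideanSpace ℝ (Fin 3)) →L[ℝ] (EuclideanSpace ℝ (Fin 3))) :
    0 ≤ 2 * frobeniusNormSq L - ‖curlCLM L‖ ^ 2 := by
  have := norm_curlCLM_sq_le L
  linarith

/-- **The stretching density under a vorticity bound.** If `div U(y) = 0` and `‖Ω(y)‖ ≤ C_ω`
(`C_ω ≥ 0`), then `⟪DU(y) Ω(y), Ω(y)⟫ ≤ γ ((2|DU(y)|²_F − ‖curl U(y)‖²) + ‖Ω(y)‖²)` with
`γ = C_ω √3 / 6` (from `3a² ≤ X‖Ω‖⁴ ≤ X C_ω² ‖Ω‖²` and AM–GM, `4γ² = C_ω²/3`). Here `Ω` is any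
vector; in the application `Ω = curl U`. [folklore] -/
theorem inner_fderiv_apply_le_of_norm_le {U : (EuclideanSpace ℝ (Fin 3)) → (EuclideanSpace ℝ (Fin 3))}
    {y : EuclideanSpace ℝ (Fin 3)} (hdiv : VectorCalculus.divergence U y = 0)
    {Cω : ℝ} (hCω : 0 ≤ Cω) {Ω : EuclideanSpace ℝ (Fin 3)} (hΩ : ‖Ω‖ ≤ Cω) :
    ⟪fderiv ℝ U y Ω, Ω⟫ ≤ Cω * Real.sqrt 3 / 6 *
      ((2 * frobeniusNormSq (fderiv ℝ U y) - ‖curl U y‖ ^ 2) + ‖Ω‖ ^ 2) := by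
  set L := fderiv ℝ U y with hLdef
  have htr : ∑ i, L ((EuclideanSpace.basisFun (Fin 3) ℝ) i) i = 0 := by
    rw [← traceCLM_eq_sum_coord, hLdef, ← divergence_eq_traceCLM]; exact hdiv
  set a : ℝ := ⟪L Ω, Ω⟫ with hadef
  set X : ℝ := 2 * frobeniusNormSq L - ‖curlCLM L‖ ^ 2 with hXdef
  set n : ℝ := ‖Ω‖ ^ 2 with hndef
  set γ : ℝ := Cω * Real.sqrt 3 / 6 with hγdef
  have hX0 : 0 ≤ X := two_mul_frobeniusNormSq_sub_nonneg L
  have hn0 : 0 ≤ n := sq_nonneg _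
  have hγ0 : 0 ≤ γ := by positivity
  have h3 : 3 * a ^ 2 ≤ X * n ^ 2 := by
    have := three_mul_sq_inner_apply_le L htr Ω
    rwa [show ‖Ω‖ ^ 4 = (‖Ω‖ ^ 2) ^ 2 by ring] at this
  have hnC : n ≤ Cω ^ 2 := by
    rw [hndef]; exact pow_le_pow_left₀ (norm_nonneg _) hΩ 2
  have h4 : a ^ 2 ≤ 4 * γ ^ 2 * (X * n) := by
    have hγ2 : 4 * γ ^ 2 = Cω ^ 2 / 3 := by
      rw [hγdef, div_pow, mul_pow, Real.sq_sqrt (by norm_num : (0:ℝ) ≤ 3)]; ring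
    rw [hγ2]
    have : X * n ^ 2 ≤ X * (Cω ^ 2 * n) := by
      rw [sq]; exact mul_le_mul_of_nonneg_left (mul_le_mul_of_nonneg_right hnC hn0) hX0
    nlinarith
  have hkey : a ≤ γ * (X + n) := by
    have hsq : a ^ 2 ≤ (γ * (X + n)) ^ 2 := by nlinarith [sq_nonneg (X - n)]
    have hnn : 0 ≤ γ * (X + n) := by positivity
    exact abs_le_of_sq_le_sq' hsq hnn |>.2
  rw [curl_eq_curlCLM]
  exact hkey

end Kinematics

/-! ### The stretching term of the budget priced by the vorticity amplitude -/

section Stretching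

/-- **`∫ |DU(s)|²_F = ∫ ‖Ω(s)‖²` on the stratum** (file 1/3's `div`–`curl` identity applied to the
`C²`, divergence-free, `L⁶` slice `U(s)` with `DU(s) ∈ L²`). [folklore] -/
theorem integral_frobeniusNormSq_fderiv_lerayOrbit_eq (hV : IsTypeIAncientMild C V) {K : ℝ}
    (hK : ∀ t : ℝ, t < 0 → ∫⁻ x, ‖fderiv ℝ (V t) x‖ₑ ^ 2 ≤ ENNReal.ofReal (K / Real.sqrt (-t)))
    (s : ℝ) :
    ∫ y, frobeniusNormSq (fderiv ℝ (lerayOrbit V s) y) = ∫ y, ‖lerayVorticity V s y‖ ^ 2 := by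
  have hU2 : ContDiff ℝ 2 (lerayOrbit V s) := mustSqueeze_contDiff_lerayOrbit_slice hV s (n := 2)
  have hdiv : VectorCalculus.IsDivFree (lerayOrbit V s) :=
    (isDivFree_lerayOrbit_iff V s).2 (hV.isDivFree (neg_neg_of_pos (Real.exp_pos _)))
  obtain ⟨hint, -⟩ := integrable_sq_norm_fderiv_lerayOrbit hV hK s
  rw [integral_frobeniusNormSq_fderiv_eq_of_isDivFree hU2 hdiv hint
    (integrable_pow_six_norm_lerayOrbit hV hK s)]
  rfl

/-- **The stretching term against the squared cutoff, priced by the vorticity amplitude (sharp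
form).** If `‖Ω(s,y)‖ ≤ C_ω` for all `y` (`C_ω ≥ 0`), then for every `R > 0`:
`2∫φ_R²⟪DU Ω, Ω⟫ ≤ (2 C_ω √3 / 3) ∫ ‖Ω(s)‖²` (`= (2/√3) C_ω Z_∞(s)`): pointwise
`φ²⟪DUΩ,Ω⟫ ≤ max(0, ⟪DUΩ,Ω⟫) ≤ γ((2|DU|²_F − ‖curl U‖²) + ‖Ω‖²)` (`inner_fderiv_apply_le_of_norm_le`,
`γ = C_ω√3/6`), and `∫(2|DU|²_F − ‖curl U‖²) = 2Z_∞ − Z_∞ = Z_∞`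
(`integral_frobeniusNormSq_fderiv_lerayOrbit_eq`). [folklore] -/
theorem two_mul_integral_sqCutoff_stretching_le_sharp (hV : IsTypeIAncientMild C V) {K : ℝ}
    (hK : ∀ t : ℝ, t < 0 → ∫⁻ x, ‖fderiv ℝ (V t) x‖ₑ ^ 2 ≤ ENNReal.ofReal (K / Real.sqrt (-t)))
    {Cω : ℝ} (hCω : 0 ≤ Cω) (s : ℝ) (hΩ : ∀ y, ‖lerayVorticity V s y‖ ≤ Cω) {R : ℝ} (hR : 0 < R) :
    2 * (∫ y, smoothTransition (2 - ‖y‖ ^ 2 / R ^ 2) ^ 2 *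
        ⟪fderiv ℝ (lerayOrbit V s) y (lerayVorticity V s y), lerayVorticity V s y⟫) ≤
      (2 * Cω * Real.sqrt 3 / 3) * ∫ y, ‖lerayVorticity V s y‖ ^ 2 := by
  set φ : (EuclideanSpace ℝ (Fin 3)) → ℝ := fun z => smoothTransition (2 - ‖z‖ ^ 2 / R ^ 2) with hφdef
  set Ω := lerayVorticity V s with hΩdef
  set U := lerayOrbit V s with hUdef
  set γ : ℝ := Cω * Real.sqrt 3 / 6 with hγdef
  have hγ0 : 0 ≤ γ := by positivity
  obtain ⟨hint, -⟩ := integrable_sq_norm_fderiv_lerayOrbit hV hK s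
  obtain ⟨hintΩ, -⟩ := integrable_sq_norm_lerayVorticity hV hK s
  have hF := integral_frobeniusNormSq_fderiv_lerayOrbit_eq hV hK s
  rw [← hUdef] at hint hF
  rw [← hΩdef] at hintΩ hF
  have hΩ1 : ContDiff ℝ 1 Ω := signedBudget_contDiff_lerayVorticity_slice hV s (n := 1)
  have hU1 : ContDiff ℝ 1 U := mustSqueeze_contDiff_lerayOrbit_slice hV s (n := 1)
  have hcΩ : Continuous Ω := hΩ1.continuous
  have hcDU : Continuous (fderiv ℝ U) := hU1.continuous_fderiv one_ne_zero
  have hcφ : Continuous φ := (contDiff_smoothTransition_cutoff (n := 1) R).continuous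
  have hdiv : VectorCalculus.IsDivFree U :=
    (isDivFree_lerayOrbit_iff V s).2 (hV.isDivFree (neg_neg_of_pos (Real.exp_pos _)))
  have hcurl : ∀ y, curl U y = Ω y := fun y => rfl
  -- pointwise
  have hpt : ∀ y, φ y ^ 2 * ⟪fderiv ℝ U y (Ω y), Ω y⟫ ≤
      γ * (2 * frobeniusNormSq (fderiv ℝ U y) - ‖Ω y‖ ^ 2) + γ * ‖Ω y‖ ^ 2 := by
    intro y
    have hφ1 : φ y ^ 2 ≤ 1 := sqCutoff_le_one R y
    have hφ0 : 0 ≤ φ y ^ 2 := sq_nonneg _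
    have hk := inner_fderiv_apply_le_of_norm_le (hdiv y) hCω (hΩ y)
    rw [hcurl y, ← hγdef] at hk
    have hX0 : 0 ≤ 2 * frobeniusNormSq (fderiv ℝ U y) - ‖Ω y‖ ^ 2 := by
      rw [← hcurl y, curl_eq_curlCLM]; exact two_mul_frobeniusNormSq_sub_nonneg _
    have hrhs0 : 0 ≤ γ * (2 * frobeniusNormSq (fderiv ℝ U y) - ‖Ω y‖ ^ 2 + ‖Ω y‖ ^ 2) := by
      positivity
    rcases le_or_gt 0 ⟪fderiv ℝ U y (Ω y), Ω y⟫ with ha | ha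
    · calc φ y ^ 2 * ⟪fderiv ℝ U y (Ω y), Ω y⟫ ≤ 1 * ⟪fderiv ℝ U y (Ω y), Ω y⟫ :=
            mul_le_mul_of_nonneg_right hφ1 ha
        _ ≤ _ := by rw [one_mul]; linarith
    · have : φ y ^ 2 * ⟪fderiv ℝ U y (Ω y), Ω y⟫ ≤ 0 :=
        mul_nonpos_iff.2 (Or.inl ⟨hφ0, ha.le⟩)
      linarith
  -- integrate
  have hφ2c : HasCompactSupport fun z : (EuclideanSpace ℝ (Fin 3)) => φ z ^ 2 := hasCompactSupport_sqCutoff hR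
  have iS : Integrable fun y => φ y ^ 2 * ⟪fderiv ℝ U y (Ω y), Ω y⟫ :=
    ((hcφ.pow 2).mul ((hcDU.clm_apply hcΩ).inner hcΩ)).integrable_of_hasCompactSupport hφ2c.mul_right
  have iF : Integrable fun y => frobeniusNormSq (fderiv ℝ U y) := integrable_frobeniusNormSq_fderiv hU1 hint
  have iX : Integrable fun y => γ * (2 * frobeniusNormSq (fderiv ℝ U y) - ‖Ω y‖ ^ 2) :=
    ((iF.const_mul 2).sub hintΩ).const_mul γ
  have iR : Integrable fun y => γ * (2 * frobeniusNormSq (fderiv ℝ U y) - ‖Ω y‖ ^ 2) + γ * ‖Ω y‖ ^ 2 :=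
    iX.add (hintΩ.const_mul γ)
  have hmono := integral_mono iS iR hpt
  rw [integral_add iX (hintΩ.const_mul γ), integral_const_mul, integral_const_mul,
    integral_sub (iF.const_mul 2) hintΩ, integral_const_mul, hF] at hmono
  have e : γ * (2 * (∫ y, ‖Ω y‖ ^ 2) - ∫ y, ‖Ω y‖ ^ 2) + γ * ∫ y, ‖Ω y‖ ^ 2 =
      (Cω * Real.sqrt 3 / 3) * ∫ y, ‖Ω y‖ ^ 2 := by rw [hγdef]; ring
  rw [e] at hmono
  linarith

end Stretching

end Summit.NavierStokesRegularity.NavierStokesRegularity.Theorems.FiniteDissipationLiouville.VorticityAmplitude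

end
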